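import Mathlib
import Summits.AtomisticToContinuum.Crystallization.Theorems.NashClassCertificatesNashNearFieldStubLayerLandscapeTri

/-!
# Crux `NashNearField` (stmt-AtomisticToContinuum-16827), line `birth`: `TRI⅒` from NEAR′ (oblique cell) and FAR (clipped cell)

Skeleton v10.1 replaces the interval claim `stub_triLandscapeNear` (FALSE as registered: with the CLIP selection the top edge
`h = 17a/20` of the box is not outward-stable for `47/50 ≤ a < 0.9443`, e.g. `t = (47/50, 0, 0, 47/50, 0, 197/200)` has
`S² = 4.1e-5` and `W ≤ −2.6e-4`) by `stub_triLandscapeNearOblique` (NEAR′): above the top edge the reference cell is shifted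
obliquely, `a′ = min 1 (a + ¼·max 0 (√6/3·t₂₂ − 17a/20))`, `h′ =` clip of `√6/3·t₂₂` to `[39a′/50, 17a′/20]`, and the claim is
`c·S′² ≤ W(t; a′, h′)` on the clip-near region `S² ≤ 1/100` (`S′` the Frobenius distance to the oblique cell).  This file is the
bookkeeping `NEAR′ ∧ FAR ⟹ TRI⅒` (`triLandscapeTenth_of_nearOblique_far`): in the near case use the oblique cell
(`|T p − D′p|² ≤ 9S′²`, `tri_penalty_sq_le`), in the far case the clipped cell (`100 w₀·min(·,1/10)² ≤ w₀ ≤ W`); `κ = min(c/9, 100w₀)`.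
With the landed `stub_layerLandscapeTenth_of_tri` (QR gauge) this gives `LL⅒` from NEAR′ and FAR.
-/

noncomputable section

open scoped BigOperators
open Literature.MathematicalPhysics.StatisticalMechanics Literature.Geometry.DiscreteGeometry

namespace Summit.AtomisticToContinuum.Crystallization.Theorems.NashClassCertificatesNashNearField

/-- The oblique selection lands in the box: `a′ = min 1 (a + ¼·max 0 (√6/3·t₂₂ − 17a/20))`, `h′ =` clip to `[39a′/50, 17a′/20]`. [folklore] -/
theorem tri_piOblique_mem_box (t₀₀ t₁₁ t₂₂ a h a' h' : ℝ) (ha : a = max (47 / 50) (min 1 ((t₀₀ + t₁₁) / 2)))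
    (_hh : h = max (39 / 50 * a) (min (17 / 20 * a) (Real.sqrt 6 / 3 * t₂₂)))
    (ha' : a' = min 1 (a + 1 / 4 * max 0 (Real.sqrt 6 / 3 * t₂₂ - 17 / 20 * a)))
    (hh' : h' = max (39 / 50 * a') (min (17 / 20 * a') (Real.sqrt 6 / 3 * t₂₂))) :
    47 / 50 ≤ a' ∧ a' ≤ 1 ∧ 39 / 50 * a' ≤ h' ∧ h' ≤ 17 / 20 * a' := by
  have ha1 : 47 / 50 ≤ a := by rw [ha]; exact le_max_left _ _
  have hm : 0 ≤ 1 / 4 * max 0 (Real.sqrt 6 / 3 * t₂₂ - 17 / 20 * a) := by positivity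
  have ha1' : 47 / 50 ≤ a' := by
    rw [ha']
    exact le_min (by norm_num) (by linarith)
  have ha2' : a' ≤ 1 := by rw [ha']; exact min_le_left _ _
  refine ⟨ha1', ha2', ?_, ?_⟩
  · rw [hh']; exact le_max_left _ _
  · rw [hh']
    exact max_le (by linarith) (min_le_left _ _)

/-- Scalar bookkeeping, near case: `P ≤ 9S²` and `cS² ≤ W` give `min(c/9, 100w₀)·min(√P, 1/10)² ≤ W`. [folklore] -/
theorem tri_bookkeeping_near {c w₀ S2 P2 B W : ℝ} (hc : 0 < c) (hw : 0 < w₀) (hP0 : 0 ≤ P2) (hB : B ≤ 9)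
    (hpen : P2 ≤ S2 * B) (hS0 : 0 ≤ S2) (hN : c * S2 ≤ W) :
    min (c / 9) (100 * w₀) * (min (Real.sqrt P2) (1 / 10)) ^ 2 ≤ W := by
  have hκ1 : min (c / 9) (100 * w₀) ≤ c / 9 := min_le_left _ _
  have hpen' : P2 ≤ S2 * 9 := hpen.trans (mul_le_mul_of_nonneg_left hB hS0)
  have hm0 : 0 ≤ min (Real.sqrt P2) (1 / 10) := le_min (Real.sqrt_nonneg _) (by norm_num)
  have hmP : (min (Real.sqrt P2) (1 / 10)) ^ 2 ≤ P2 := by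
    calc (min (Real.sqrt P2) (1 / 10)) ^ 2 ≤ (Real.sqrt P2) ^ 2 := pow_le_pow_left₀ hm0 (min_le_left _ _) 2
      _ = P2 := Real.sq_sqrt hP0
  have hw' : 0 < 100 * w₀ := by positivity
  have hmin0 : 0 ≤ min (c / 9) (100 * w₀) := le_min (by positivity) hw'.le
  calc min (c / 9) (100 * w₀) * (min (Real.sqrt P2) (1 / 10)) ^ 2 ≤ (c / 9) * P2 :=
        mul_le_mul hκ1 hmP (sq_nonneg _) (by positivity)
    _ ≤ c * S2 := by nlinarith [hpen', hc]
    _ ≤ W := hN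

/-- Scalar bookkeeping, far case: `w₀ ≤ W` gives `min(c/9, 100w₀)·min(√P, 1/10)² ≤ W`. [folklore] -/
theorem tri_bookkeeping_far {c w₀ P2 W : ℝ} (hc : 0 < c) (hw : 0 < w₀) (hF : w₀ ≤ W) :
    min (c / 9) (100 * w₀) * (min (Real.sqrt P2) (1 / 10)) ^ 2 ≤ W := by
  have hκ2 : min (c / 9) (100 * w₀) ≤ 100 * w₀ := min_le_right _ _
  have hm0 : 0 ≤ min (Real.sqrt P2) (1 / 10) := le_min (Real.sqrt_nonneg _) (by norm_num)
  have hm1 : (min (Real.sqrt P2) (1 / 10)) ^ 2 ≤ 1 / 100 := by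
    calc (min (Real.sqrt P2) (1 / 10)) ^ 2 ≤ (1 / 10) ^ 2 := pow_le_pow_left₀ hm0 (min_le_right _ _) 2
      _ = 1 / 100 := by norm_num
  have _h := hc
  calc min (c / 9) (100 * w₀) * (min (Real.sqrt P2) (1 / 10)) ^ 2 ≤ (100 * w₀) * (1 / 100) :=
        mul_le_mul hκ2 hm1 (sq_nonneg _) (by positivity)
    _ = w₀ := by ring
    _ ≤ W := hF

/-- **`TRI⅒` from NEAR′ and FAR (v10.1; the landed `stub_triLandscapeTenth_of_near_far` re-proved with the oblique cell in the near case).**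
Case `S²(clip) ≤ 1/100`: use the oblique cell `(a′, h′)` — `|T p − D′ p|² ≤ 9 S′²` and `c·S′² ≤ W(a′, h′)`; case `1/100 ≤ S²(clip)`: use the
clipped cell — `100w₀·min(·, 1/10)² ≤ w₀ ≤ W(a, h)`.  `κ = min(c/9, 100 w₀)`. [folklore] -/
theorem triLandscapeTenth_of_nearOblique_far :
    (∃ c : ℝ, 0 < c ∧ ∀ t₀₀ t₀₁ t₀₂ t₁₁ t₁₂ t₂₂ a h a' h' : ℝ, 0 < t₀₀ → 0 < t₁₁ → 0 < t₂₂ →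
        (∀ x y z : ℝ, (4 / 5 : ℝ) ^ 2 * (x ^ 2 + y ^ 2 + z ^ 2) ≤
          (t₀₀ * x + t₀₁ * y + t₀₂ * z) ^ 2 + (t₁₁ * y + t₁₂ * z) ^ 2 + (t₂₂ * z) ^ 2 ∧
        (t₀₀ * x + t₀₁ * y + t₀₂ * z) ^ 2 + (t₁₁ * y + t₁₂ * z) ^ 2 + (t₂₂ * z) ^ 2 ≤
          (6 / 5 : ℝ) ^ 2 * (x ^ 2 + y ^ 2 + z ^ 2)) →
        a = max (47 / 50) (min 1 ((t₀₀ + t₁₁) / 2)) →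
        h = max (39 / 50 * a) (min (17 / 20 * a) (Real.sqrt 6 / 3 * t₂₂)) →
        a' = min 1 (a + 1 / 4 * max 0 (Real.sqrt 6 / 3 * t₂₂ - 17 / 20 * a)) →
        h' = max (39 / 50 * a') (min (17 / 20 * a') (Real.sqrt 6 / 3 * t₂₂)) →
        ((t₀₀ - a) ^ 2 + (t₁₁ - a) ^ 2 + (t₂₂ - h / (Real.sqrt 6 / 3)) ^ 2 + t₀₁ ^ 2 + t₀₂ ^ 2 + t₁₂ ^ 2) ≤ 1 / 100 →
        c * ((t₀₀ - a') ^ 2 + (t₁₁ - a') ^ 2 + (t₂₂ - h' / (Real.sqrt 6 / 3)) ^ 2 + t₀₁ ^ 2 + t₀₂ ^ 2 + t₁₂ ^ 2) ≤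
        (fun Δ : ℤ → ℤ → ℝ => (1 / 2 : ℝ) * (Δ 0 0 +
            (∑' k : ℕ, if k = 0 then min (Δ 1 1) (Δ (-1) 1)
              else min (Δ 0 ((k : ℤ) + 1)) (min (Δ 1 ((k : ℤ) + 1)) (Δ (-1) ((k : ℤ) + 1)))) +
            (∑' k : ℕ, if k = 0 then min (Δ 1 (-1)) (Δ (-1) (-1))
              else min (Δ 0 (-((k : ℤ) + 1))) (min (Δ 1 (-((k : ℤ) + 1))) (Δ (-1) (-((k : ℤ) + 1)))))))
          (fun δ s => (∑' ij : ℤ × ℤ, lennardJones (Real.sqrt ((t₀₀ * ((ij.1 : ℝ) + (ij.2 : ℝ) / 2 + (δ : ℝ) / 2) + t₀₁ * (Real.sqrt 3 / 2 * ((ij.2 : ℝ) + (δ : ℝ) / 3)) + t₀₂ * ((s : ℝ) * (Real.sqrt 6 / 3))) ^ 2 + (t₁₁ * (Real.sqrt 3 / 2 * ((ij.2 : ℝ) + (δ : ℝ) / 3)) + t₁₂ * ((s : ℝ) * (Real.sqrt 6 / 3))) ^ 2 + (t₂₂ * ((s : ℝ) * (Real.sqrt 6 / 3))) ^ 2)))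 -
            layerInteraction lennardJones a' h' δ s)) →
    (∃ w₀ : ℝ, 0 < w₀ ∧ ∀ t₀₀ t₀₁ t₀₂ t₁₁ t₁₂ t₂₂ a h : ℝ, 0 < t₀₀ → 0 < t₁₁ → 0 < t₂₂ →
        (∀ x y z : ℝ, (4 / 5 : ℝ) ^ 2 * (x ^ 2 + y ^ 2 + z ^ 2) ≤
          (t₀₀ * x + t₀₁ * y + t₀₂ * z) ^ 2 + (t₁₁ * y + t₁₂ * z) ^ 2 + (t₂₂ * z) ^ 2 ∧
        (t₀₀ * x + t₀₁ * y + t₀₂ * z) ^ 2 + (t₁₁ * y + t₁₂ * z) ^ 2 + (t₂₂ * z) ^ 2 ≤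
          (6 / 5 : ℝ) ^ 2 * (x ^ 2 + y ^ 2 + z ^ 2)) →
        a = max (47 / 50) (min 1 ((t₀₀ + t₁₁) / 2)) →
        h = max (39 / 50 * a) (min (17 / 20 * a) (Real.sqrt 6 / 3 * t₂₂)) →
        1 / 100 ≤ ((t₀₀ - a) ^ 2 + (t₁₁ - a) ^ 2 + (t₂₂ - h / (Real.sqrt 6 / 3)) ^ 2 + t₀₁ ^ 2 + t₀₂ ^ 2 + t₁₂ ^ 2) →
        w₀ ≤
        (fun Δ : ℤ → ℤ → ℝ => (1 / 2 : ℝ) * (Δ 0 0 +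
            (∑' k : ℕ, if k = 0 then min (Δ 1 1) (Δ (-1) 1)
              else min (Δ 0 ((k : ℤ) + 1)) (min (Δ 1 ((k : ℤ) + 1)) (Δ (-1) ((k : ℤ) + 1)))) +
            (∑' k : ℕ, if k = 0 then min (Δ 1 (-1)) (Δ (-1) (-1))
              else min (Δ 0 (-((k : ℤ) + 1))) (min (Δ 1 (-((k : ℤ) + 1))) (Δ (-1) (-((k : ℤ) + 1)))))))
          (fun δ s => (∑' ij : ℤ × ℤ, lennardJones (Real.sqrt ((t₀₀ * ((ij.1 : ℝ) + (ij.2 : ℝ) / 2 + (δ : ℝ) / 2) + t₀₁ * (Real.sqrt 3 / 2 * ((ij.2 : ℝ) + (δ : ℝ) / 3)) + t₀₂ * ((s : ℝ) * (Real.sqrt 6 / 3))) ^ 2 + (t₁₁ * (Real.sqrt 3 / 2 * ((ij.2 : ℝ) + (δ : ℝ) / 3)) + t₁₂ * ((s : ℝ) * (Real.sqrt 6 / 3))) ^ 2 + (t₂₂ * ((s : ℝ) * (Real.sqrt 6 / 3))) ^ 2))) -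
            layerInteraction lennardJones a h δ s)) →
    ∃ κ : ℝ, 0 < κ ∧ ∀ t₀₀ t₀₁ t₀₂ t₁₁ t₁₂ t₂₂ : ℝ, 0 < t₀₀ → 0 < t₁₁ → 0 < t₂₂ →
        (∀ x y z : ℝ, (4 / 5 : ℝ) ^ 2 * (x ^ 2 + y ^ 2 + z ^ 2) ≤
          (t₀₀ * x + t₀₁ * y + t₀₂ * z) ^ 2 + (t₁₁ * y + t₁₂ * z) ^ 2 + (t₂₂ * z) ^ 2 ∧
        (t₀₀ * x + t₀₁ * y + t₀₂ * z) ^ 2 + (t₁₁ * y + t₁₂ * z) ^ 2 + (t₂₂ * z) ^ 2 ≤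
          (6 / 5 : ℝ) ^ 2 * (x ^ 2 + y ^ 2 + z ^ 2)) →
        ∃ a h : ℝ, 47 / 50 ≤ a ∧ a ≤ 1 ∧ 39 / 50 * a ≤ h ∧ h ≤ 17 / 20 * a ∧
          ∀ δ k i j : ℤ, ‖layerVec 1 (Real.sqrt 6 / 3) δ k i j‖ ≤ 3 →
            κ * (min (Real.sqrt (((t₀₀ - a) * ((i : ℝ) + (j : ℝ) / 2 + (δ : ℝ) / 2) + t₀₁ * (Real.sqrt 3 / 2 * ((j : ℝ) + (δ : ℝ) / 3)) + t₀₂ * ((k : ℝ) * (Real.sqrt 6 / 3))) ^ 2 + ((t₁₁ - a) * (Real.sqrt 3 / 2 * ((j : ℝ) + (δ : ℝ) / 3)) + t₁₂ * ((k : ℝ) * (Real.sqrt 6 / 3))) ^ 2 + ((t₂₂ - h / (Real.sqrt 6 / 3)) * ((k : ℝ) * (Real.sqrt 6 / 3))) ^ 2)) (1 / 10)) ^ 2 ≤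
            (fun Δ : ℤ → ℤ → ℝ => (1 / 2 : ℝ) * (Δ 0 0 +
              (∑' k : ℕ, if k = 0 then min (Δ 1 1) (Δ (-1) 1)
                else min (Δ 0 ((k : ℤ) + 1)) (min (Δ 1 ((k : ℤ) + 1)) (Δ (-1) ((k : ℤ) + 1)))) +
              (∑' k : ℕ, if k = 0 then min (Δ 1 (-1)) (Δ (-1) (-1))
                else min (Δ 0 (-((k : ℤ) + 1))) (min (Δ 1 (-((k : ℤ) + 1))) (Δ (-1) (-((k : ℤ) + 1)))))))
            (fun δ s => (∑' ij : ℤ × ℤ, lennardJones (Real.sqrt ((t₀₀ * ((ij.1 : ℝ) + (ij.2 : ℝ) / 2 + (δ : ℝ) / 2) + t₀₁ * (Real.sqrt 3 / 2 * ((ij.2 : ℝ) + (δ : ℝ) / 3)) + t₀₂ * ((s : ℝ) * (Real.sqrt 6 / 3))) ^ 2 + (t₁₁ * (Real.sqrt 3 / 2 * ((ij.2 : ℝ) + (δ : ℝ) / 3)) + t₁₂ * ((s : ℝ) * (Real.sqrt 6 / 3))) ^ 2 + (t₂₂ * ((s : ℝ) * (Real.sqrt 6 / 3))) ^ 2)))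 -
              layerInteraction lennardJones a h δ s) := by
  rintro ⟨c, hc, hN⟩ ⟨w₀, hw₀, hF⟩
  refine ⟨min (c / 9) (100 * w₀), lt_min (by positivity) (by positivity), ?_⟩
  intro t₀₀ t₀₁ t₀₂ t₁₁ t₁₂ t₂₂ h00 h11 h22 htube
  obtain ⟨a, ha⟩ : ∃ a : ℝ, a = max (47 / 50) (min 1 ((t₀₀ + t₁₁) / 2)) := ⟨_, rfl⟩
  obtain ⟨h, hh⟩ : ∃ h : ℝ, h = max (39 / 50 * a) (min (17 / 20 * a) (Real.sqrt 6 / 3 * t₂₂)) := ⟨_, rfl⟩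
  obtain ⟨a', ha'⟩ : ∃ a' : ℝ, a' = min 1 (a + 1 / 4 * max 0 (Real.sqrt 6 / 3 * t₂₂ - 17 / 20 * a)) := ⟨_, rfl⟩
  obtain ⟨h', hh'⟩ : ∃ h' : ℝ, h' = max (39 / 50 * a') (min (17 / 20 * a') (Real.sqrt 6 / 3 * t₂₂)) := ⟨_, rfl⟩
  by_cases hS : ((t₀₀ - a) ^ 2 + (t₁₁ - a) ^ 2 + (t₂₂ - h / (Real.sqrt 6 / 3)) ^ 2 + t₀₁ ^ 2 + t₀₂ ^ 2 + t₁₂ ^ 2) ≤ 1 / 100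
  · -- near: the oblique cell
    obtain ⟨ha1, ha2, hh1, hh2⟩ := tri_piOblique_mem_box t₀₀ t₁₁ t₂₂ a h a' h' ha hh ha' hh'
    refine ⟨a', h', ha1, ha2, hh1, hh2, fun δ k i j hn => ?_⟩
    have hB : ((i : ℝ) + (j : ℝ) / 2 + (δ : ℝ) / 2) ^ 2 + (Real.sqrt 3 / 2 * ((j : ℝ) + (δ : ℝ) / 3)) ^ 2 + ((k : ℝ) * (Real.sqrt 6 / 3)) ^ 2 ≤ 9 := by
      rw [← tri_norm_layerVec_sq]
      nlinarith [norm_nonneg (layerVec 1 (Real.sqrt 6 / 3) δ k i j)]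
    exact tri_bookkeeping_near hc hw₀ (by positivity) hB (tri_penalty_sq_le t₀₀ t₀₁ t₀₂ t₁₁ t₁₂ t₂₂ a' h' _ _ _)
      (by positivity) (hN t₀₀ t₀₁ t₀₂ t₁₁ t₁₂ t₂₂ a h a' h' h00 h11 h22 htube ha hh ha' hh' hS)
  · -- far: the clipped cell
    obtain ⟨ha1, ha2, hh1, hh2⟩ := tri_pi_mem_box t₀₀ t₁₁ t₂₂ a h ha hh
    refine ⟨a, h, ha1, ha2, hh1, hh2, fun δ k i j _hn => ?_⟩
    exact tri_bookkeeping_far hc hw₀ (hF t₀₀ t₀₁ t₀₂ t₁₁ t₁₂ t₂₂ a h h00 h11 h22 htube ha hh (not_le.1 hS).le)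

end Summit.AtomisticToContinuum.Crystallization.Theorems.NashClassCertificatesNashNearField

end
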